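import Summits.AtomisticToContinuum.Crystallization.Theses.IsometryAtoms
import Literature.MathematicalPhysics.StatisticalMechanics.BarlowStacking
import Literature.MathematicalPhysics.StatisticalMechanics.HcpHomogeneous
import Summits.AtomisticToContinuum.Crystallization.Theorems.LayeredLawsSelectHcp.Negative.FccEnergy

/-!
# Negative knowledge for crux `MinimisingLawsHaveAtoms` (stmt-AtomisticToContinuum-15776), IV:
# line `IdeatorOneSketch` — the content stub `stub_strictCalibrationHcp` forces a STRICT energy
# gap above `e*` for every Bravais lattice (in particular fcc at every scale)

Standing crux disprover `cdisprove-stmt-AtomisticToContinuum-15776`,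
`--supports stmt-AtomisticToContinuum-15776`.  The lead's line `IdeatorOneSketch`
(idea `strict-calibration-exactness`) concludes the crux from the registered content stub
`stub_strictCalibrationHcp` (quoted VERBATIM as the hypothesis `H` below): for every hard core
`δ > 0` a bounded finite-hop jointly measurable bond transfer `t` and box parameters `a, h` with
(i) `e* ≤ h(μ) + div t(μ)` on EVERY rooted `δ`-hard-core `μ` and (ii) equality only when the root's
closed `11a/5`-ball is exactly that of a rooted isometric copy of `hcpStacking a h`.

What the stub costs, kernel-checked:

* `integral_transfer_div_addSubgroup` — at the counting measure of a countable additive subgroup `L`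
  of `ℝ³` the divergence `∫ (t μ y − t (θ_y μ) (−y)) dμ` VANISHES for every transfer `t` (no
  measurability, boundedness or integrability needed: `θ_y count|L = count|L` on `L` and `count|L`
  is odd-symmetric).  So (i) restricted to lattices is the known `e* ≤ e(L)`, and
* `eStar_lt_rootEnergy_addSubgroup_of_stub` — (ii) can never fire at a lattice: `L ∩ B̄(0, 11a/5)` is
  centrosymmetric, the corresponding patch of `hcpStacking a h` around any site is NOT (the
  adjacent-layer neighbour `p₀ = barlowPos a h alternatingHagg 1 0 0` has `‖p₀‖ = √(a²/3+h²) ≤ 11a/5`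
  and `−p₀ ∉ hcp`; sites are moved to the origin by the landed `hcpStacking_homogeneous`).  HENCE THE
  STUB IMPLIES `e* < rootEnergy (count|L)` FOR EVERY δ-SEPARATED ADDITIVE SUBGROUP `L` OF `ℝ³`,
  whatever its rank; in particular (`eStar_lt_energyPerParticle_fccPC_of_stub`)
  `e* < e(fccPC a)` for EVERY `a > 0`: fcc is a Lennard-Jones periodic minimiser at NO scale.
* `stub_strictCalibrationHcp_false_of_fcc_minimiser` — contrapositive, NEGATIVE LEMMA MODULO the
  (believed false, `Δ_{fcc/hcp}(12,6) ≈ −1.0·10⁻⁴`) hypothesis "fcc attains `e*` at some scale".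

Moral for the lead: any proof of `stub_strictCalibrationHcp` contains a certified proof that NO
Bravais lattice of `ℝ³` (fcc, bcc, sc, …, at any scale) attains `e*` — in particular a certified
hcp-beats-fcc lattice-sum comparison at relative precision `10⁻⁴` (in tree only conditionally:
`LayeredLawsSelectHcp.Negative.ThresholdSensitivity.eStar_lt_fcc_of_crux`).  The calibration `t` is
invisible on lattices; all of that burden sits in the strictness clause (ii).  All `[folklore]`.
-/

noncomputable section

namespace Summit.AtomisticToContinuum.Crystallization.Theorems.MinimisingLawsHaveAtoms.Negative.StrictCalibrationLatticeGap

open MeasureTheory Set Metric Function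
open scoped ENNReal
open Literature.MathematicalPhysics.StatisticalMechanics Literature.Probability.Process
open Summit.AtomisticToContinuum.Crystallization.Theorems.ChargedEnergyGapNegative (eStar eStar_le)
open Summit.AtomisticToContinuum.Crystallization.Theorems.LayeredLawsSelectHcp.Negative.DiracLaws
  (map_count_restrict_eq meanRootEnergy)
open Summit.AtomisticToContinuum.Crystallization.Theorems.LayeredLawsSelectHcp.Negative.FccLattice
  (fccD3 countable_fccD3 le_dist_of_mem_fccD3)
open Summit.AtomisticToContinuum.Crystallization.Theorems.LayeredLawsSelectHcp.Negative.FccModel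
  (fccLaw meanRootEnergy_fccLaw)
open Summit.AtomisticToContinuum.Crystallization.Theorems.LayeredLawsSelectHcp.Negative.FccEnergy
  (fccPC meanRootEnergy_fccLaw_eq_energyPerParticle)

/-! ## §1 The divergence of any transfer vanishes at a lattice -/

/-- `θ_y (count|L) = count|L` for `y` in the countable additive subgroup `L`. [folklore] -/
theorem map_sub_count_restrict_addSubgroup (L : AddSubgroup (EuclideanSpace ℝ (Fin 3))) (hL : (L : Set (EuclideanSpace ℝ (Fin 3))).Countable)
    {y : (EuclideanSpace ℝ (Fin 3))} (hy : y ∈ (L : Set (EuclideanSpace ℝ (Fin 3)))) :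
    Measure.map (fun z => z - y) ((Measure.count : Measure (EuclideanSpace ℝ (Fin 3))).restrict (L : Set (EuclideanSpace ℝ (Fin 3)))) =
      (Measure.count : Measure (EuclideanSpace ℝ (Fin 3))).restrict (L : Set (EuclideanSpace ℝ (Fin 3))) := by
  have : (fun z : (EuclideanSpace ℝ (Fin 3)) => z - y) = ⇑(MeasurableEquiv.subRight y) := rfl
  rw [this]
  refine map_count_restrict_eq _ hL ?_
  ext z
  simp only [Set.mem_preimage, SetLike.mem_coe]
  change z - y ∈ L ↔ z ∈ L
  exact ⟨fun h => by simpa using L.add_mem h hy, fun h => L.sub_mem h hy⟩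

/-- `count|L` is invariant under `y ↦ −y`. [folklore] -/
theorem map_neg_count_restrict_addSubgroup (L : AddSubgroup (EuclideanSpace ℝ (Fin 3))) (hL : (L : Set (EuclideanSpace ℝ (Fin 3))).Countable) :
    Measure.map (MeasurableEquiv.neg (EuclideanSpace ℝ (Fin 3))) ((Measure.count : Measure (EuclideanSpace ℝ (Fin 3))).restrict (L : Set (EuclideanSpace ℝ (Fin 3)))) =
      (Measure.count : Measure (EuclideanSpace ℝ (Fin 3))).restrict (L : Set (EuclideanSpace ℝ (Fin 3))) := by
  refine map_count_restrict_eq _ hL ?_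
  ext z
  simp only [Set.mem_preimage, SetLike.mem_coe]
  change -z ∈ L ↔ z ∈ L
  exact neg_mem_iff

/-- **The divergence of every transfer vanishes at a lattice**: for a countable additive subgroup
`L` of `ℝ³` and ANY `t : Measure ℝ³ → ℝ³ → ℝ`,
`∫ (t μ y − t (θ_y μ) (−y)) dμ(y) = 0` at `μ = count|L` — on `L` the shifted configuration is `μ`
itself, and the remaining integrand `y ↦ t μ y − t μ (−y)` is odd while `μ` is even (Bochner
integrals; no integrability needed: both sides of `∫ g = −∫ g` take the junk value together).
[folklore] -/
theorem integral_transfer_div_addSubgroup (L : AddSubgroup (EuclideanSpace ℝ (Fin 3))) (hL : (L : Set (EuclideanSpace ℝ (Fin 3))).Countable)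
    (t : Measure (EuclideanSpace ℝ (Fin 3)) → (EuclideanSpace ℝ (Fin 3)) → ℝ) :
    ∫ y, (t ((Measure.count : Measure (EuclideanSpace ℝ (Fin 3))).restrict (L : Set (EuclideanSpace ℝ (Fin 3)))) y -
        t (Measure.map (fun z => z - y) ((Measure.count : Measure (EuclideanSpace ℝ (Fin 3))).restrict (L : Set (EuclideanSpace ℝ (Fin 3))))) (-y))
      ∂((Measure.count : Measure (EuclideanSpace ℝ (Fin 3))).restrict (L : Set (EuclideanSpace ℝ (Fin 3)))) = 0 := by
  set ν := (Measure.count : Measure (EuclideanSpace ℝ (Fin 3))).restrict (L : Set (EuclideanSpace ℝ (Fin 3))) with hν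
  have hLm : MeasurableSet (L : Set (EuclideanSpace ℝ (Fin 3))) := hL.measurableSet
  set G : (EuclideanSpace ℝ (Fin 3)) → ℝ := fun y => t ν y - t ν (-y) with hG
  have h1 : (fun y => t ν y - t (Measure.map (fun z => z - y) ν) (-y)) =ᵐ[ν] G := by
    filter_upwards [ae_restrict_mem hLm] with y hy
    rw [hG, map_sub_count_restrict_addSubgroup L hL hy]
  rw [integral_congr_ae h1]
  have hodd : ∀ y, G (-y) = -G y := fun y => by simp only [hG, neg_neg]; ring
  have h2 : ∫ y, G y ∂ν = -∫ y, G y ∂ν :=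
    calc ∫ y, G y ∂ν = ∫ y, G y ∂(Measure.map (MeasurableEquiv.neg (EuclideanSpace ℝ (Fin 3))) ν) := by
          rw [map_neg_count_restrict_addSubgroup L hL]
      _ = ∫ y, G ((MeasurableEquiv.neg (EuclideanSpace ℝ (Fin 3))) y) ∂ν := integral_map_equiv _ _
      _ = ∫ y, -G y ∂ν := integral_congr_ae (Filter.Eventually.of_forall fun y => hodd y)
      _ = -∫ y, G y ∂ν := integral_neg _
  linarith

/-! ## §2 The hcp patch of radius `11a/5` is not centrosymmetric -/

/-- The origin is a site of `hcpStacking a h`. [folklore] -/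
theorem zero_mem_hcpStacking (a h : ℝ) : (0 : (EuclideanSpace ℝ (Fin 3))) ∈ hcpStacking a h :=
  ⟨0, 0, 0, by simp [barlowPos]⟩

/-- `p₀ ∈ hcp`. [folklore] -/
theorem p0_mem (a h : ℝ) : barlowPos a h alternatingHagg 1 0 0 ∈ hcpStacking a h := barlowPos_mem 1 0 0

/-- `‖p₀‖ = √(a²/3 + h²)`. [folklore] -/
theorem norm_p0 (a h : ℝ) : ‖barlowPos a h alternatingHagg 1 0 0‖ = Real.sqrt (a ^ 2 / 3 + h ^ 2) := by
  have h0 : barlowPos a h alternatingHagg 0 0 0 = 0 := by simp [barlowPos]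
  rw [← dist_zero_right, ← h0, show (1 : ℤ) = 0 + 1 by norm_num]
  exact dist_barlowPos_succ_eq a h isHaggSeq_alternating 0 0 0

/-- On the box `h ≤ 17a/20` (`a ≥ 0`), `‖p₀‖ ≤ 11a/5`. [folklore] -/
theorem norm_p0_le {a h : ℝ} (ha : 0 ≤ a) (hh0 : 0 ≤ h) (hh : h ≤ 17 / 20 * a) :
    ‖barlowPos a h alternatingHagg 1 0 0‖ ≤ 11 / 5 * a := by
  rw [norm_p0]
  calc Real.sqrt (a ^ 2 / 3 + h ^ 2) ≤ Real.sqrt ((11 / 5 * a) ^ 2) :=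
        Real.sqrt_le_sqrt (by nlinarith [mul_nonneg hh0 (by linarith : (0 : ℝ) ≤ 17 / 20 * a - h)])
    _ = 11 / 5 * a := Real.sqrt_sq (by positivity)

/-- **`−p₀ ∉ hcp`** (`a ≠ 0`, `h ≠ 0`): `−p₀` would lie in layer `−1`, whose lateral label is again
`B`, at lateral position `−w`; but `−w ∉ w + (ℤu + ℤv)` (the second coordinate forces `3j = −2`).
[folklore] -/
theorem neg_p0_not_mem {a h : ℝ} (ha : a ≠ 0) (hh : h ≠ 0) : -barlowPos a h alternatingHagg 1 0 0 ∉ hcpStacking a h := by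
  rintro ⟨k, i, j, hk⟩
  have h3 : (Real.sqrt 3 : ℝ) ≠ 0 := by positivity
  -- third coordinate: `k = -1`
  have e2 := congrArg (fun v : (EuclideanSpace ℝ (Fin 3)) => v 2) hk
  simp only [PiLp.neg_apply, barlowPos_apply_two, Int.cast_one, one_mul] at e2
  have hk1 : (k : ℝ) = -1 := by
    have : ((k : ℝ) + 1) * h = 0 := by linarith
    rcases mul_eq_zero.1 this with h1 | h1
    · linarith
    · exact absurd h1 hh
  have hk1' : k = -1 := by exact_mod_cast hk1
  subst hk1'
  -- second coordinate: `3 j = -2`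
  have e1 := congrArg (fun v : (EuclideanSpace ℝ (Fin 3)) => v 1) hk
  have hL1 : haggLabel alternatingHagg 1 = 1 := haggLabel_alternating_of_odd (by decide)
  have hLm1 : haggLabel alternatingHagg (-1) = 1 := haggLabel_alternating_of_odd (by decide)
  simp only [PiLp.neg_apply, barlowPos_apply_one, hL1, hLm1, Int.cast_one, Int.cast_zero,
    zero_add] at e1
  have hj : (3 : ℝ) * j = -2 := by
    have hne : a * Real.sqrt 3 / 2 ≠ 0 := by positivity
    have := mul_left_cancel₀ hne (show a * Real.sqrt 3 / 2 * (-(1 / 3 : ℝ)) =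
      a * Real.sqrt 3 / 2 * ((j : ℝ) + 1 / 3) by linarith)
    linarith
  have hj' : (3 : ℤ) * j = -2 := by exact_mod_cast hj
  omega

/-- **The hcp patch is not centrosymmetric about any site**: for `q ∈ hcp` there is `p ∈ hcp` with
`‖p − q‖ = ‖p₀‖` and `2q − p ∉ hcp` (homogeneity `hcpStacking_homogeneous` transports `p₀`). Stated
in the form used below: no linear isometric rooted copy `A(hcp − q)` is centrosymmetric on the ball
of radius `‖p₀‖`. [folklore] -/
theorem not_centrosymm_hcp_copy {a h : ℝ} (ha : a ≠ 0) (hh : h ≠ 0) (A : (EuclideanSpace ℝ (Fin 3)) →ₗᵢ[ℝ] (EuclideanSpace ℝ (Fin 3)))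
    {q : (EuclideanSpace ℝ (Fin 3))} (hq : q ∈ hcpStacking a h) {r : ℝ} (hr : ‖barlowPos a h alternatingHagg 1 0 0‖ ≤ r)
    (hsymm : ∀ z ∈ (fun s => A (s - q)) '' hcpStacking a h, ‖z‖ ≤ r →
      -z ∈ (fun s => A (s - q)) '' hcpStacking a h) : False := by
  obtain ⟨B, hB⟩ := hcpStacking_homogeneous a h hq
  -- the transported witness `q + B p₀ ∈ hcp`
  have hmem : q + B (barlowPos a h alternatingHagg 1 0 0) ∈ hcpStacking a h := (hB _).1 (p0_mem a h)
  have hz : A (B (barlowPos a h alternatingHagg 1 0 0)) ∈ (fun s => A (s - q)) '' hcpStacking a h :=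
    ⟨q + B (barlowPos a h alternatingHagg 1 0 0), hmem, by simp⟩
  have hnorm : ‖A (B (barlowPos a h alternatingHagg 1 0 0))‖ ≤ r := by
    rwa [A.norm_map, B.norm_map]
  obtain ⟨s, hs, hsz⟩ := hsymm _ hz hnorm
  -- `A (s - q) = -A (B p₀)` forces `s = q + B (-p₀)`, so `-p₀ ∈ hcp`
  have hsq : s - q = B (-(barlowPos a h alternatingHagg 1 0 0)) := by
    apply A.injective
    rw [map_neg, A.map_neg]
    exact hsz
  have hs' : q + B (-(barlowPos a h alternatingHagg 1 0 0)) ∈ hcpStacking a h := by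
    rw [← hsq, add_sub_cancel]
    exact hs
  exact neg_p0_not_mem ha hh ((hB _).2 hs')

/-! ## §3 The stub forces a strict gap above `e*` at every lattice -/

/-- Equal restrictions of counting measures to a measurable set have equal traces. [folklore] -/
theorem inter_eq_of_count_restrict_restrict_eq {S T B : Set (EuclideanSpace ℝ (Fin 3))} (hB : MeasurableSet B)
    (h : ((Measure.count : Measure (EuclideanSpace ℝ (Fin 3))).restrict S).restrict B =
      ((Measure.count : Measure (EuclideanSpace ℝ (Fin 3))).restrict T).restrict B) :
    B ∩ S = B ∩ T := by
  rw [Measure.restrict_restrict hB, Measure.restrict_restrict hB] at h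
  ext x
  rw [← count_restrict_singleton_ne_zero_iff (B ∩ S) x, h, count_restrict_singleton_ne_zero_iff]

/-- **The content stub of line `IdeatorOneSketch` forces `e* < h(count|L)` for every `δ`-separated
additive subgroup `L` of `ℝ³`** (hypothesis `H` = `stub_strictCalibrationHcp` verbatim): weak
duality (i) at `count|L` reads `e* ≤ h(count|L)` because the divergence vanishes
(`integral_transfer_div_addSubgroup`), and equality would trigger strictness (ii), i.e. make the
centrosymmetric patch `L ∩ B̄(0, 11a/5)` equal to a non-centrosymmetric hcp patch
(`not_centrosymm_hcp_copy`). [folklore] -/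
theorem eStar_lt_rootEnergy_addSubgroup_of_stub
    (H : ∀ δ : ℝ, 0 < δ → ∃ a h : ℝ, 0 < a ∧ 39 / 50 * a ≤ h ∧ h ≤ 17 / 20 * a ∧
      ∃ (R M : ℝ) (t : Measure (EuclideanSpace ℝ (Fin 3)) → EuclideanSpace ℝ (Fin 3) → ℝ),
        Measurable (Function.uncurry t) ∧ (∀ μ y, |t μ y| ≤ M) ∧ (∀ μ y, R < ‖y‖ → t μ y = 0) ∧
        (∀ μ : Measure (EuclideanSpace ℝ (Fin 3)), IsRootedHardCore δ μ →
          (⨅ Q : PeriodicConfiguration 3, Q.energyPerParticle lennardJones) ≤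
            rootEnergy lennardJones μ +
              ∫ y, (t μ y - t (Measure.map (fun z => z - y) μ) (-y)) ∂μ) ∧
        (∀ μ : Measure (EuclideanSpace ℝ (Fin 3)), IsRootedHardCore δ μ →
          rootEnergy lennardJones μ +
              ∫ y, (t μ y - t (Measure.map (fun z => z - y) μ) (-y)) ∂μ =
            (⨅ Q : PeriodicConfiguration 3, Q.energyPerParticle lennardJones) →
          ∃ ν ∈ {μ : Measure (EuclideanSpace ℝ (Fin 3)) |
              ∃ A : EuclideanSpace ℝ (Fin 3) →ₗᵢ[ℝ] EuclideanSpace ℝ (Fin 3),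
                ∃ q ∈ hcpStacking a h,
                  μ = (Measure.count : Measure (EuclideanSpace ℝ (Fin 3))).restrict
                    ((fun s => A (s - q)) '' hcpStacking a h)},
            μ.restrict (Metric.closedBall (0 : EuclideanSpace ℝ (Fin 3)) (11 / 5 * a)) =
              ν.restrict (Metric.closedBall (0 : EuclideanSpace ℝ (Fin 3)) (11 / 5 * a))))
    (L : AddSubgroup (EuclideanSpace ℝ (Fin 3))) {δ : ℝ} (hδ : 0 < δ)
    (hsep : ∀ x ∈ (L : Set (EuclideanSpace ℝ (Fin 3))), ∀ y ∈ (L : Set (EuclideanSpace ℝ (Fin 3))), x ≠ y → δ ≤ dist x y)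
    (hL : (L : Set (EuclideanSpace ℝ (Fin 3))).Countable) :
    eStar < rootEnergy lennardJones ((Measure.count : Measure (EuclideanSpace ℝ (Fin 3))).restrict (L : Set (EuclideanSpace ℝ (Fin 3)))) := by
  obtain ⟨a, h, ha, hh1, hh2, R, M, t, -, -, -, hweak, hstrict⟩ := H δ hδ
  set ν := (Measure.count : Measure (EuclideanSpace ℝ (Fin 3))).restrict (L : Set (EuclideanSpace ℝ (Fin 3))) with hν
  have hhc : IsRootedHardCore δ ν := ⟨L, L.zero_mem, hsep, rfl⟩
  have hdiv := integral_transfer_div_addSubgroup L hL t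
  have hge : eStar ≤ rootEnergy lennardJones ν := by
    have := hweak ν hhc
    rwa [hdiv, add_zero] at this
  refine lt_of_le_of_ne hge fun heq => ?_
  have hEq : rootEnergy lennardJones ν +
      ∫ y, (t ν y - t (Measure.map (fun z => z - y) ν) (-y)) ∂ν =
        ⨅ Q : PeriodicConfiguration 3, Q.energyPerParticle lennardJones := by
    rw [hdiv, add_zero]
    exact heq.symm
  obtain ⟨ν', ⟨A, q, hq, rfl⟩, hagree⟩ := hstrict ν hhc hEq
  have hh0 : 0 < h := by linarith
  set B : Set (EuclideanSpace ℝ (Fin 3)) := Metric.closedBall (0 : (EuclideanSpace ℝ (Fin 3))) (11 / 5 * a) with hBdef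
  have htrace : B ∩ (L : Set (EuclideanSpace ℝ (Fin 3))) = B ∩ ((fun s => A (s - q)) '' hcpStacking a h) :=
    inter_eq_of_count_restrict_restrict_eq measurableSet_closedBall hagree
  refine not_centrosymm_hcp_copy ha.ne' hh0.ne' A hq (norm_p0_le ha.le hh0.le hh2) ?_
  intro z hz hzr
  have hzB : z ∈ B ∩ ((fun s => A (s - q)) '' hcpStacking a h) :=
    ⟨mem_closedBall_zero_iff.2 hzr, hz⟩
  rw [← htrace] at hzB
  have hnegB : -z ∈ B ∩ (L : Set (EuclideanSpace ℝ (Fin 3))) :=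
    ⟨by rw [mem_closedBall_zero_iff, norm_neg]; exact hzr, L.neg_mem hzB.2⟩
  rw [htrace] at hnegB
  exact hnegB.2

/-- **Corollary: the stub forces `e* < e(fcc a)` at EVERY scale `a > 0`** — fcc (a Bravais
lattice, landed as `fccD3 a` / `fccPC`) is a Lennard-Jones periodic minimiser at no scale. Any
proof of `stub_strictCalibrationHcp` therefore contains a certified hcp-beats-fcc lattice-sum
comparison (relative size `10⁻⁴`). [folklore] -/
theorem eStar_lt_energyPerParticle_fccPC_of_stub
    (H : ∀ δ : ℝ, 0 < δ → ∃ a h : ℝ, 0 < a ∧ 39 / 50 * a ≤ h ∧ h ≤ 17 / 20 * a ∧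
      ∃ (R M : ℝ) (t : Measure (EuclideanSpace ℝ (Fin 3)) → EuclideanSpace ℝ (Fin 3) → ℝ),
        Measurable (Function.uncurry t) ∧ (∀ μ y, |t μ y| ≤ M) ∧ (∀ μ y, R < ‖y‖ → t μ y = 0) ∧
        (∀ μ : Measure (EuclideanSpace ℝ (Fin 3)), IsRootedHardCore δ μ →
          (⨅ Q : PeriodicConfiguration 3, Q.energyPerParticle lennardJones) ≤
            rootEnergy lennardJones μ +
              ∫ y, (t μ y - t (Measure.map (fun z => z - y) μ) (-y)) ∂μ) ∧
        (∀ μ : Measure (EuclideanSpace ℝ (Fin 3)), IsRootedHardCore δ μ →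
          rootEnergy lennardJones μ +
              ∫ y, (t μ y - t (Measure.map (fun z => z - y) μ) (-y)) ∂μ =
            (⨅ Q : PeriodicConfiguration 3, Q.energyPerParticle lennardJones) →
          ∃ ν ∈ {μ : Measure (EuclideanSpace ℝ (Fin 3)) |
              ∃ A : EuclideanSpace ℝ (Fin 3) →ₗᵢ[ℝ] EuclideanSpace ℝ (Fin 3),
                ∃ q ∈ hcpStacking a h,
                  μ = (Measure.count : Measure (EuclideanSpace ℝ (Fin 3))).restrict
                    ((fun s => A (s - q)) '' hcpStacking a h)},
            μ.restrict (Metric.closedBall (0 : EuclideanSpace ℝ (Fin 3)) (11 / 5 * a)) =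
              ν.restrict (Metric.closedBall (0 : EuclideanSpace ℝ (Fin 3)) (11 / 5 * a))))
    {a : ℝ} (ha : 0 < a) :
    eStar < (fccPC ha.ne').energyPerParticle lennardJones := by
  have h := eStar_lt_rootEnergy_addSubgroup_of_stub H (fccD3 a) ha
    (fun x hx y hy hne => le_dist_of_mem_fccD3 ha hx hy hne) (countable_fccD3 a)
  rwa [rootEnergy_def, ← meanRootEnergy_fccLaw, meanRootEnergy_fccLaw_eq_energyPerParticle ha.ne']
    at h

/-- **Negative lemma modulo "fcc is optimal at some scale"**: if `e(fccPC a) = e*` for some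
`a > 0` (believed FALSE — hcp is lower by `≈ 10⁻⁴ |e*|` — but not refuted in tree), the content stub
of line `IdeatorOneSketch` is false. [folklore] -/
theorem stub_strictCalibrationHcp_false_of_fcc_minimiser
    (hfcc : ∃ a : ℝ, ∃ ha : 0 < a, (fccPC ha.ne').energyPerParticle lennardJones = eStar) :
    ¬ (∀ δ : ℝ, 0 < δ → ∃ a h : ℝ, 0 < a ∧ 39 / 50 * a ≤ h ∧ h ≤ 17 / 20 * a ∧
      ∃ (R M : ℝ) (t : Measure (EuclideanSpace ℝ (Fin 3)) → EuclideanSpace ℝ (Fin 3) → ℝ),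
        Measurable (Function.uncurry t) ∧ (∀ μ y, |t μ y| ≤ M) ∧ (∀ μ y, R < ‖y‖ → t μ y = 0) ∧
        (∀ μ : Measure (EuclideanSpace ℝ (Fin 3)), IsRootedHardCore δ μ →
          (⨅ Q : PeriodicConfiguration 3, Q.energyPerParticle lennardJones) ≤
            rootEnergy lennardJones μ +
              ∫ y, (t μ y - t (Measure.map (fun z => z - y) μ) (-y)) ∂μ) ∧
        (∀ μ : Measure (EuclideanSpace ℝ (Fin 3)), IsRootedHardCore δ μ →
          rootEnergy lennardJones μ +
              ∫ y, (t μ y - t (Measure.map (fun z => z - y) μ) (-y)) ∂μ =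
            (⨅ Q : PeriodicConfiguration 3, Q.energyPerParticle lennardJones) →
          ∃ ν ∈ {μ : Measure (EuclideanSpace ℝ (Fin 3)) |
              ∃ A : EuclideanSpace ℝ (Fin 3) →ₗᵢ[ℝ] EuclideanSpace ℝ (Fin 3),
                ∃ q ∈ hcpStacking a h,
                  μ = (Measure.count : Measure (EuclideanSpace ℝ (Fin 3))).restrict
                    ((fun s => A (s - q)) '' hcpStacking a h)},
            μ.restrict (Metric.closedBall (0 : EuclideanSpace ℝ (Fin 3)) (11 / 5 * a)) =
              ν.restrict (Metric.closedBall (0 : EuclideanSpace ℝ (Fin 3)) (11 / 5 * a)))) := by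
  intro H
  obtain ⟨a, ha, hfa⟩ := hfcc
  exact (eStar_lt_energyPerParticle_fccPC_of_stub H ha).ne' hfa

end Summit.AtomisticToContinuum.Crystallization.Theorems.MinimisingLawsHaveAtoms.Negative.StrictCalibrationLatticeGap

end
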